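import Summits.Ventures.YMGap.RobustBall.SummableMassGap
import Summits.Ventures.YMGap.RobustBall.MassGapOnBallS
import Literature.Probability.LatticeModels.DobrushinMetricInfiniteRange
import Literature.Probability.LatticeModels.ONModelDobrushinStates
import HarnessLib

/-!
# Venture YMGap, track ROBUST-BALL — ONE STATE AT A RATE, TIER 2: SUMMABLE (infinite-range) members forget
# their boundary condition exponentially fast

HONEST FRAMING. WHAT THIS IS: a venture file (cell `pub-ymgap`, track Y2 ROBUST-BALL, seat ds-3, theorems only), the TIER-2
twin of `BoundaryDecay.lean`. A tier-2 member is `N β S_W + W` with `W` ANY link potential on `ℤ^d` with continuous own-link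
terms and a summable majorant (no range cut-off; specification `perturbedYMS`, rb-p1's `SummableSpecification.lean`). Its
Dobrushin matrix `C⁰(e, y)` (`SummableUniqueness.lean`) has SUMMABLE rows, so the finite-neighbourhood comparison theorem behind
tier 1 (`DustingData.abs_sub_le_sum_pow_profile`) does not apply. This file replaces it by lit-1's INFINITE-RANGE comparison
estimate `DobrushinMetric.abs_sub_le_tsum_weighted` (Föllmer 1988, Ch. I, (2.8) with Cor. (2.14) and the conditional
specification (2.10)) with USABLE SET the finite volume `Λ`:
* `BoundaryDecayS.abs_kernel_sub_integral_le_tsum_weighted` — ★ GENERIC (any specification `γ` on any `V → S` whose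
  one-site laws obey the global Kantorovich–Rubinstein bound with summable rows `≤ c < 1` on `Λ`; any Gibbs measure `μ`; any
  weight `0 ≤ θ ≤ 1`, `= 1` off `Λ`, with `∑' C x y θ y ≤ c θ x` on `Λ`): for a bounded measurable local `f` with
  coordinatewise Lipschitz bound `δ`, `|∫ f dγ_Λ(·|η) − ∫ f dμ| ≤ R ∑_{y ∈ Δ_f} θ y δ y` — the kernel `γ_Λ(·|η)` is an
  invariant state of the one-site operators `γ_x`, `x ∈ Λ` (consistency), `μ` of all of them (DLR);
* `BoundaryDecayS.abs_kernel_sub_integral_le_exp_profile` / `_exp_dist` — with the WEIGHTED rows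
  `∑' C x y e^{t d(x,y)} ≤ c` (`x ∈ Λ`) and a `d`-Lipschitz profile `ρ ≥ 0` vanishing off `Λ`: `≤ R ∑ e^{−t ρ y} δ y`,
  `≤ R (∑ δ) e^{−t m}` if `ρ ≥ m` on `Δ_f`;
* ★★ `abs_boundaryS_sub_integral_le` — TIER 2, `SU(N)`, `d ≥ 1`: under rb-p1's single weighted ROW CONDITION
  `6(d−1)|β| e^{a} e^{t} √(c v) + e^{a/2} √c Λ_t < 1` (the hypothesis of `perturbedMassGapS_SU`, same loads, same one-link
  pair `(c, v)`), for EVERY DLR state `μ` of the member, every finite volume `Λ`, EVERY boundary field `η` and every Lipschitz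
  cylinder `F` (constant `K`) on `Δ` at `ℓ^∞`-depth `≥ D` inside `Λ`:
  `|∫ F dγ^{W,S}_Λ(· | η) − ∫ F dμ| ≤ 2√N · K · #Δ · e^{−t D}` — the boundary is forgotten at the clustering rate `t`.
The `SU(2)` readings (sharp pair, `MemBallZdS`, boxes) and the two-boundary-fields form are in `BoundaryDecaySummableSU2.lean`.
WHAT THIS IS NOT: strong-coupling LATTICE statements inside the tier-2 ball; the rate is the Dobrushin weight `t`, not a
spectral gap; nothing about the continuum limit or the Clay Millennium problem.

References: H. Föllmer, LNM 1362 (1988), Ch. I, (2.8), (2.10), Cor. (2.14), Remark (2.17); H.-O. Georgii, *Gibbs Measures and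
Phase Transitions* (2011), Thm. 8.20, Remark 8.26, (8.29); lit-1's `DobrushinMetricInfiniteRange.lean`; rb-p1's
`SummableUniqueness.lean`, `SummableMassGap.lean`; the seat's `BoundaryDecay.lean` (tier 1).
-/

noncomputable section

open MeasureTheory Filter Function ProbabilityTheory Real Topology
open scoped NNReal
open Literature.Probability.LatticeModels
open Literature.Probability.LatticeModels.DobrushinMetric
open Literature.MathematicalPhysics.QuantumLattice
open Literature.MathematicalPhysics.QuantumFieldTheory hiding ZdEdge

namespace Summit.Ventures.YMGap.RobustBall

/-! ### Generic: a finite-volume kernel against a Gibbs measure, summable rows, weighted -/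

namespace BoundaryDecayS

variable {V S : Type*} [MeasurableSpace S] {γ : Specification V S} {r : S → S → ℝ} {C : V → V → ℝ}

/-- ★ **Föllmer's comparison estimate (2.8)/(2.10) with Cor. (2.14), kernel versus Gibbs measure, INFINITE RANGE with summable
rows**: let the one-site laws of `γ` satisfy the global Kantorovich–Rubinstein bound
`|∫ φ dγ_x(·|ω) − ∫ φ dγ_x(·|η)| ≤ L ∑' y, C x y · r(ω y, η y)` (`0 ≤ r ≤ R`, `r a a = 0`, `C ≥ 0` with summable rows). For a
finite volume `Λ` with rows `∑' y, C x y ≤ c < 1` (`x ∈ Λ`), a weight `0 ≤ θ ≤ 1` equal to `1` OFF `Λ` with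
`∑' y, C x y θ y ≤ c θ x` (`x ∈ Λ`), a Gibbs measure `μ`, ANY boundary condition `η` and a bounded measurable `f` depending on
`Δ_f` with coordinatewise Lipschitz bound `δ`: `|∫ f dγ_Λ(·|η) − ∫ f dμ| ≤ R ∑_{y ∈ Δ_f} θ y δ y`. The kernel is an invariant
state of the one-site operators `γ_x`, `x ∈ Λ` (consistency), `μ` of all of them (DLR). [cite: Follmer1988, Ch. I (2.10)] -/
theorem abs_kernel_sub_integral_le_tsum_weighted [DecidableEq V] (hγ : IsSpecification γ)
    {R : ℝ} (hr0 : ∀ a b, 0 ≤ r a b) (hrR : ∀ a b, r a b ≤ R) (hR : 0 ≤ R) (hr00 : ∀ a, r a a = 0)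
    (hC0 : ∀ x y, 0 ≤ C x y) (hCs : ∀ x, Summable (C x))
    (hcontr : ∀ (x : V) (ω η : V → S) (φ : S → ℝ) (L : ℝ), Measurable φ →
      (∃ M, ∀ s, |φ s| ≤ M) → 0 ≤ L → (∀ a b, |φ a - φ b| ≤ L * r a b) →
      |∫ s, φ s ∂(siteLaw γ x ω) - ∫ s, φ s ∂(siteLaw γ x η)| ≤ L * ∑' y, C x y * r (ω y) (η y))
    {μ : Measure (V → S)} (hμ : IsGibbsMeasure γ μ) (Λ : Finset V) (η : V → S)
    {f : (V → S) → ℝ} (hfm : Measurable f) {Δf : Finset V} (hfdep : DependsOn f (↑Δf : Set V))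
    {Mf : ℝ} (hMf : ∀ σ, |f σ| ≤ Mf) {δf : V → ℝ} (hδf : IsLipBound r f δf)
    {c : ℝ} (hc0 : 0 ≤ c) (hc1 : c < 1) (hrow : ∀ x ∈ Λ, ∑' y, C x y ≤ c)
    {θ : V → ℝ} (hθ0 : ∀ y, 0 ≤ θ y) (hθ1 : ∀ y, θ y ≤ 1) (hθΛ : ∀ y ∉ Λ, θ y = 1)
    (hroww : ∀ x ∈ Λ, ∑' y, C x y * θ y ≤ c * θ x) :
    |∫ σ, f σ ∂(γ Λ η) - ∫ σ, f σ ∂μ| ≤ R * ∑ y ∈ Δf, θ y * δf y := by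
  classical
  haveI := hμ.isProbabilityMeasure
  haveI := hγ.isProbability Λ η
  -- the two predicates of the abstract layer (Föllmer's class `L(Ω)`)
  set Adm : ((V → S) → ℝ) → Prop := fun F => Measurable F ∧ ∃ M, ∀ σ, |F σ| ≤ M with hAdmdef
  set Lip : ((V → S) → ℝ) → (V → ℝ) → Prop := fun F δ =>
    (∀ y, 0 ≤ δ y) ∧ Summable δ ∧ ∀ σ τ, |F σ - F τ| ≤ ∑' y, δ y * r (σ y) (τ y) with hLipdef
  have hlip0 : ∀ ⦃F : (V → S) → ℝ⦄ ⦃δ : V → ℝ⦄, Lip F δ → ∀ y, 0 ≤ δ y := fun F δ h => h.1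
  have hlips : ∀ ⦃F : (V → S) → ℝ⦄ ⦃δ : V → ℝ⦄, Lip F δ → Summable δ := fun F δ h => h.2.1
  have hosc : ∀ ⦃F : (V → S) → ℝ⦄ ⦃δ : V → ℝ⦄, Adm F → Lip F δ →
      ∀ σ τ, |F σ - F τ| ≤ R * ∑' y, δ y := by
    intro F δ _ h σ τ
    obtain ⟨hδ0, hδs, hδ⟩ := h
    refine (hδ σ τ).trans ?_
    have hs : Summable fun y => δ y * r (σ y) (τ y) :=
      Summable.of_nonneg_of_le (fun y => mul_nonneg (hδ0 y) (hr0 _ _))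
        (fun y => mul_le_mul_of_nonneg_left (hrR _ _) (hδ0 y)) (hδs.mul_right R)
    calc ∑' y, δ y * r (σ y) (τ y) ≤ ∑' y, δ y * R :=
          hs.tsum_le_tsum (fun y => mul_le_mul_of_nonneg_left (hrR _ _) (hδ0 y)) (hδs.mul_right R)
      _ = R * ∑' y, δ y := by rw [tsum_mul_right, mul_comm]
  have hT : ∀ ⦃F : (V → S) → ℝ⦄ (x : V), Adm F → Adm (siteAvg γ x F) := fun F x hF => by
    obtain ⟨hFm, M, hM⟩ := hF
    exact ⟨measurable_siteAvg hγ x hFm, M, fun σ => abs_siteAvg_le hγ x hM σ⟩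
  have hdust : ∀ ⦃F : (V → S) → ℝ⦄ ⦃δ : V → ℝ⦄ (x : V), Adm F → Lip F δ →
      Lip (siteAvg γ x F) fun y => if y = x then 0 else δ y + C x y * δ x := fun F δ x hF h => by
    obtain ⟨hFm, M, hM⟩ := hF
    obtain ⟨hδ0, hδs, hδ⟩ := h
    refine ⟨fun y => ?_, ?_, lip_siteAvg_tsum hγ hr0 hrR hr00 hC0 hCs hcontr x hFm hM hδ0 hδs hδ⟩
    · show 0 ≤ (if y = x then 0 else δ y + C x y * δ x)
      split_ifs
      · exact le_rfl
      · exact add_nonneg (hδ0 y) (mul_nonneg (hC0 x y) (hδ0 x))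
    · exact Summable.of_nonneg_of_le
        (fun y => by
          split_ifs; exacts [le_rfl, add_nonneg (hδ0 y) (mul_nonneg (hC0 x y) (hδ0 x))])
        (fun y => by
          split_ifs
          · exact add_nonneg (hδ0 y) (mul_nonneg (hC0 x y) (hδ0 x))
          · exact le_rfl)
        (hδs.add ((hCs x).mul_right (δ x)))
  -- `E₁ = γ_Λ(·|η)`: monotone-normalised, invariant under `γ_x`, `x ∈ Λ` (consistency)
  have h₁le : ∀ ⦃F : (V → S) → ℝ⦄ ⦃M : ℝ⦄, Adm F → (∀ σ, F σ ≤ M) → ∫ σ, F σ ∂(γ Λ η) ≤ M := by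
    intro F M hF hM
    obtain ⟨hFm, B, hB⟩ := hF
    calc ∫ σ, F σ ∂(γ Λ η) ≤ ∫ _σ, M ∂(γ Λ η) :=
          integral_mono (integrable_of_abs_le' hFm hB) (integrable_const M) hM
      _ = M := by simp
  have h₁ge : ∀ ⦃F : (V → S) → ℝ⦄ ⦃M : ℝ⦄, Adm F → (∀ σ, M ≤ F σ) → M ≤ ∫ σ, F σ ∂(γ Λ η) := by
    intro F M hF hM
    obtain ⟨hFm, B, hB⟩ := hF
    calc M = ∫ _σ, M ∂(γ Λ η) := by simp
      _ ≤ ∫ σ, F σ ∂(γ Λ η) :=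
          integral_mono (integrable_const M) (integrable_of_abs_le' hFm hB) hM
  have h₁T : ∀ ⦃F : (V → S) → ℝ⦄ (x : V), x ∈ (↑Λ : Set V) → Adm F →
      ∫ σ, siteAvg γ x F σ ∂(γ Λ η) = ∫ σ, F σ ∂(γ Λ η) := fun F x hx hF => by
    obtain ⟨hFm, B, hB⟩ := hF
    exact hγ.integral_integral_consistent (Finset.singleton_subset_iff.2 (Finset.mem_coe.1 hx)) η
      (integrable_of_abs_le' hFm hB)
  -- `E₂ = μ`: monotone-normalised, invariant under every `γ_x` (DLR)
  have h₂le : ∀ ⦃F : (V → S) → ℝ⦄ ⦃M : ℝ⦄, Adm F → (∀ σ, F σ ≤ M) → ∫ σ, F σ ∂μ ≤ M := by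
    intro F M hF hM
    obtain ⟨hFm, B, hB⟩ := hF
    calc ∫ σ, F σ ∂μ ≤ ∫ _σ, M ∂μ := integral_mono (integrable_of_abs_le' hFm hB) (integrable_const M) hM
      _ = M := by simp
  have h₂ge : ∀ ⦃F : (V → S) → ℝ⦄ ⦃M : ℝ⦄, Adm F → (∀ σ, M ≤ F σ) → M ≤ ∫ σ, F σ ∂μ := by
    intro F M hF hM
    obtain ⟨hFm, B, hB⟩ := hF
    calc M = ∫ _σ, M ∂μ := by simp
      _ ≤ ∫ σ, F σ ∂μ := integral_mono (integrable_const M) (integrable_of_abs_le' hFm hB) hM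
  have h₂T : ∀ ⦃F : (V → S) → ℝ⦄ (x : V), x ∈ (↑Λ : Set V) → Adm F →
      ∫ σ, siteAvg γ x F σ ∂μ = ∫ σ, F σ ∂μ := fun F x _ hF => by
    obtain ⟨hFm, B, hB⟩ := hF
    exact hμ.integral_integral_eq hγ {x} (integrable_of_abs_le' hFm hB)
  -- `f` is admissible with the global Lipschitz vector `δ 𝟙_{Δ_f}`
  have hF : Adm f := ⟨hfm, Mf, hMf⟩
  have hδ' : Lip f fun y => if y ∈ Δf then δf y else 0 := by
    refine ⟨fun y => ?_, summable_of_ne_finset_zero (s := Δf) fun y hy => if_neg hy,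
      fun σ τ => abs_sub_le_tsum_of_dependsOn hfdep hδf σ τ⟩
    dsimp only
    split_ifs
    · exact hδf.nonneg y
    · exact le_rfl
  have key := abs_sub_le_tsum_weighted (W := (↑Λ : Set V)) (T := fun x F => siteAvg γ x F)
    (E₁ := fun F => ∫ σ, F σ ∂(γ Λ η)) (E₂ := fun F => ∫ σ, F σ ∂μ)
    hR hlip0 hlips hosc hC0 hCs hT hdust h₁le h₁ge h₁T h₂le h₂ge h₂T hc0 hc1
    (fun x hx => hrow x (Finset.mem_coe.1 hx)) (θ := θ) hθ0 hθ1
    (fun y hy => hθΛ y fun h => hy (Finset.mem_coe.2 h)) (fun x hx => hroww x (Finset.mem_coe.1 hx)) hF hδ'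
  have hsum : (∑' y, θ y * (if y ∈ Δf then δf y else 0)) = ∑ y ∈ Δf, θ y * δf y := by
    rw [tsum_eq_sum (s := Δf) (fun y hy => by rw [if_neg hy, mul_zero])]
    exact Finset.sum_congr rfl fun y hy => by rw [if_pos hy]
  rw [← hsum]
  exact key

/-- ★ **Exponential weights** (Föllmer 1988, Ch. I, Cor. (2.14)/(2.24); Georgii 2011, Remark 8.26): under the global bound with the
WEIGHTED rows `∑' y, C x y e^{t d(x,y)} ≤ c < 1` for `x ∈ Λ` (`d ≥ 0`, `t ≥ 0`) and a profile `ρ ≥ 0` vanishing OFF `Λ` with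
`ρ x ≤ ρ y + d(x,y)` (`x ∈ Λ`): `|∫ f dγ_Λ(·|η) − ∫ f dμ| ≤ R ∑_{y ∈ Δ_f} e^{−t ρ y} δ y`. [cite: Follmer1988, Ch. I Corollary (2.14)] -/
theorem abs_kernel_sub_integral_le_exp_profile [DecidableEq V] (hγ : IsSpecification γ)
    {R : ℝ} (hr0 : ∀ a b, 0 ≤ r a b) (hrR : ∀ a b, r a b ≤ R) (hR : 0 ≤ R) (hr00 : ∀ a, r a a = 0)
    (hC0 : ∀ x y, 0 ≤ C x y) (hCs : ∀ x, Summable (C x))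
    (hcontr : ∀ (x : V) (ω η : V → S) (φ : S → ℝ) (L : ℝ), Measurable φ →
      (∃ M, ∀ s, |φ s| ≤ M) → 0 ≤ L → (∀ a b, |φ a - φ b| ≤ L * r a b) →
      |∫ s, φ s ∂(siteLaw γ x ω) - ∫ s, φ s ∂(siteLaw γ x η)| ≤ L * ∑' y, C x y * r (ω y) (η y))
    {μ : Measure (V → S)} (hμ : IsGibbsMeasure γ μ) (Λ : Finset V) (η : V → S)
    {f : (V → S) → ℝ} (hfm : Measurable f) {Δf : Finset V} (hfdep : DependsOn f (↑Δf : Set V))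
    {Mf : ℝ} (hMf : ∀ σ, |f σ| ≤ Mf) {δf : V → ℝ} (hδf : IsLipBound r f δf)
    {c : ℝ} (hc0 : 0 ≤ c) (hc1 : c < 1) (d : V → V → ℝ) (hd : ∀ x y, 0 ≤ d x y) {t : ℝ} (ht : 0 ≤ t)
    (hsw : ∀ x ∈ Λ, Summable fun y => C x y * Real.exp (t * d x y))
    (hroww : ∀ x ∈ Λ, ∑' y, C x y * Real.exp (t * d x y) ≤ c)
    (ρ : V → ℝ) (hρ0 : ∀ y, 0 ≤ ρ y) (hρΛ : ∀ y ∉ Λ, ρ y = 0) (hρ : ∀ x ∈ Λ, ∀ y, ρ x ≤ ρ y + d x y) :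
    |∫ σ, f σ ∂(γ Λ η) - ∫ σ, f σ ∂μ| ≤ R * ∑ y ∈ Δf, Real.exp (-(t * ρ y)) * δf y := by
  have hθ0 : ∀ y, 0 ≤ Real.exp (-(t * ρ y)) := fun y => (Real.exp_pos _).le
  have hθ1 : ∀ y, Real.exp (-(t * ρ y)) ≤ 1 := fun y => Real.exp_le_one_iff.2 (by nlinarith [hρ0 y])
  have hθΛ : ∀ y ∉ Λ, Real.exp (-(t * ρ y)) = 1 := fun y hy => by rw [hρΛ y hy]; simp
  have hsθ : ∀ x, Summable fun y => C x y * Real.exp (-(t * ρ y)) := fun x =>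
    Summable.of_nonneg_of_le (fun y => mul_nonneg (hC0 x y) (hθ0 y))
      (fun y => by simpa using mul_le_mul_of_nonneg_left (hθ1 y) (hC0 x y)) (hCs x)
  have hrow : ∀ x ∈ Λ, ∑' y, C x y ≤ c := fun x hx => by
    refine le_trans ((hCs x).tsum_le_tsum (fun y => ?_) (hsw x hx)) (hroww x hx)
    have h1 : (1 : ℝ) ≤ Real.exp (t * d x y) := Real.one_le_exp (mul_nonneg ht (hd x y))
    simpa using mul_le_mul_of_nonneg_left h1 (hC0 x y)
  refine abs_kernel_sub_integral_le_tsum_weighted hγ hr0 hrR hR hr00 hC0 hCs hcontr hμ Λ η hfm hfdep hMf hδf hc0 hc1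
    hrow hθ0 hθ1 hθΛ (fun x hx => ?_)
  calc ∑' y, C x y * Real.exp (-(t * ρ y))
      ≤ ∑' y, C x y * Real.exp (t * d x y) * Real.exp (-(t * ρ x)) := by
        refine (hsθ x).tsum_le_tsum (fun y => ?_) ((hsw x hx).mul_right _)
        rw [mul_assoc, ← Real.exp_add]
        refine mul_le_mul_of_nonneg_left (Real.exp_le_exp.2 ?_) (hC0 x y)
        nlinarith [hρ x hx y]
    _ = (∑' y, C x y * Real.exp (t * d x y)) * Real.exp (-(t * ρ x)) := tsum_mul_right
    _ ≤ c * Real.exp (-(t * ρ x)) := mul_le_mul_of_nonneg_right (hroww x hx) (Real.exp_pos _).le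

/-- ★ **At depth `m`**: if moreover `ρ ≥ m` on `Δ_f` then `|∫ f dγ_Λ(·|η) − ∫ f dμ| ≤ R (∑_{Δ_f} δ) e^{−t m}` — a finite volume
forgets its boundary condition at the rate `t` of the Dobrushin weight, uniformly in the boundary condition.
[cite: Follmer1988, Ch. I Corollary (2.14)] -/
theorem abs_kernel_sub_integral_le_exp_dist [DecidableEq V] (hγ : IsSpecification γ)
    {R : ℝ} (hr0 : ∀ a b, 0 ≤ r a b) (hrR : ∀ a b, r a b ≤ R) (hR : 0 ≤ R) (hr00 : ∀ a, r a a = 0)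
    (hC0 : ∀ x y, 0 ≤ C x y) (hCs : ∀ x, Summable (C x))
    (hcontr : ∀ (x : V) (ω η : V → S) (φ : S → ℝ) (L : ℝ), Measurable φ →
      (∃ M, ∀ s, |φ s| ≤ M) → 0 ≤ L → (∀ a b, |φ a - φ b| ≤ L * r a b) →
      |∫ s, φ s ∂(siteLaw γ x ω) - ∫ s, φ s ∂(siteLaw γ x η)| ≤ L * ∑' y, C x y * r (ω y) (η y))
    {μ : Measure (V → S)} (hμ : IsGibbsMeasure γ μ) (Λ : Finset V) (η : V → S)
    {f : (V → S) → ℝ} (hfm : Measurable f) {Δf : Finset V} (hfdep : DependsOn f (↑Δf : Set V))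
    {Mf : ℝ} (hMf : ∀ σ, |f σ| ≤ Mf) {δf : V → ℝ} (hδf : IsLipBound r f δf)
    {c : ℝ} (hc0 : 0 ≤ c) (hc1 : c < 1) (d : V → V → ℝ) (hd : ∀ x y, 0 ≤ d x y) {t : ℝ} (ht : 0 ≤ t)
    (hsw : ∀ x ∈ Λ, Summable fun y => C x y * Real.exp (t * d x y))
    (hroww : ∀ x ∈ Λ, ∑' y, C x y * Real.exp (t * d x y) ≤ c)
    (ρ : V → ℝ) (hρ0 : ∀ y, 0 ≤ ρ y) (hρΛ : ∀ y ∉ Λ, ρ y = 0) (hρ : ∀ x ∈ Λ, ∀ y, ρ x ≤ ρ y + d x y)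
    {m : ℝ} (hm : ∀ y ∈ Δf, m ≤ ρ y) :
    |∫ σ, f σ ∂(γ Λ η) - ∫ σ, f σ ∂μ| ≤ R * (∑ y ∈ Δf, δf y) * Real.exp (-(t * m)) := by
  refine (abs_kernel_sub_integral_le_exp_profile hγ hr0 hrR hR hr00 hC0 hCs hcontr hμ Λ η hfm hfdep hMf hδf hc0 hc1 d hd
    ht hsw hroww ρ hρ0 hρΛ hρ).trans ?_
  have h1 : ∑ y ∈ Δf, Real.exp (-(t * ρ y)) * δf y ≤ ∑ y ∈ Δf, Real.exp (-(t * m)) * δf y :=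
    Finset.sum_le_sum fun y hy => mul_le_mul_of_nonneg_right (Real.exp_le_exp.2 (by nlinarith [hm y hy])) (hδf.nonneg y)
  calc R * ∑ y ∈ Δf, Real.exp (-(t * ρ y)) * δf y ≤ R * ∑ y ∈ Δf, Real.exp (-(t * m)) * δf y :=
        mul_le_mul_of_nonneg_left h1 hR
    _ = R * (∑ y ∈ Δf, δf y) * Real.exp (-(t * m)) := by rw [← Finset.mul_sum]; ring

end BoundaryDecayS

/-! ### Tier 2, `SU(N)`: every DLR state of a summable member forgets the boundary condition at rate `t` -/

section SUN

variable {d N : ℕ}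
variable {W : Potential (ZdEdge d) (Matrix.specialUnitaryGroup (Fin N) ℂ)} {B : Finset (ZdEdge d) → ℝ}

/-- The `ℓ^∞` depth profile `ρ(y) = max(0, D − dist(y, Δ))` of an observable on `Δ ≠ ∅` at depth `≥ D` inside `Λ`: nonnegative,
zero off `Λ`, `1`-Lipschitz for the base-point distance, `≥ D` on `Δ`. [folklore] -/
theorem depthProfileS {Λ Δ : Finset (ZdEdge d)} (hΔ : Δ.Nonempty) {D : ℝ} (hD : ∀ y ∈ Δ, ∀ z, z ∉ Λ → D ≤ ‖y.1 - z.1‖) :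
    (∀ y, 0 ≤ max 0 (D - linkSetDist Δ y)) ∧ (∀ y ∉ Λ, max 0 (D - linkSetDist Δ y) = 0) ∧
      (∀ x y : ZdEdge d, max 0 (D - linkSetDist Δ x) ≤ max 0 (D - linkSetDist Δ y) + ‖x.1 - y.1‖) ∧
      ∀ y ∈ Δ, D ≤ max 0 (D - linkSetDist Δ y) := by
  refine ⟨fun y => le_max_left _ _, fun y hy => ?_, fun x y => ?_, fun y hy => ?_⟩
  · have hdistD : D ≤ linkSetDist Δ y := by
      unfold linkSetDist
      rw [dif_pos hΔ]
      exact (Finset.le_inf'_iff hΔ _).2 fun y' hy' => by rw [norm_sub_rev]; exact hD y' hy' y hy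
    exact max_eq_left (sub_nonpos.2 hdistD)
  · have h0 : linkSetDist Δ y ≤ linkSetDist Δ x + ‖x.1 - y.1‖ := by
      have h := linkSetDist_le_add_norm Δ y x
      rwa [norm_sub_rev] at h
    refine max_le (add_nonneg (le_max_left _ _) (norm_nonneg _)) ?_
    calc D - linkSetDist Δ x ≤ D - linkSetDist Δ y + ‖x.1 - y.1‖ := by linarith
      _ ≤ max 0 (D - linkSetDist Δ y) + ‖x.1 - y.1‖ := add_le_add (le_max_right _ _) le_rfl
  · rw [linkSetDist_eq_zero_of_mem hy, sub_zero]
    exact le_max_right _ _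

/-- ★★ **TIER 2: EVERY DLR STATE OF A SUMMABLE MEMBER FORGETS THE BOUNDARY CONDITION AT THE CLUSTERING RATE `t`**
(Föllmer 1988, Ch. I, (2.10) with Cor. (2.14); Georgii 2011, Remark 8.26). Under rb-p1's weighted row condition
`6(d−1)|β| e^{a} e^{t} √(c v) + e^{a/2} √c Λ_t < 1` for the member `N β S_W + W` (one-link Poincaré/variance pair `(c, v)` on
`‖B‖_op ≤ 2(d−1)|β|`, oscillation load `a`, diagonal-free weighted cross load `Λ_t`, exactly the hypotheses of
`perturbedMassGapS_SU`): for every DLR state `μ`, every finite volume `Λ`, EVERY boundary field `η`, and every Lipschitz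
cylinder `F` (constant `K`) on a link set `Δ` whose base points are at `ℓ^∞`-distance `≥ D` from those of every link outside
`Λ`: `|∫ F dγ^{W,S}_Λ(· | η) − ∫ F dμ| ≤ 2√N · K · #Δ · e^{−t D}`. [folklore] -/
theorem abs_boundaryS_sub_integral_le (hd : 1 ≤ d) (hN : 1 ≤ N) {β b c v a Λt t : ℝ}
    (hc : 0 ≤ c) (hv : 0 ≤ v) (hb : |β| * (2 * ((d : ℝ) - 1)) ≤ b)
    (hP : ∀ B : Matrix (Fin N) (Fin N) ℂ, matrixOpNorm B ≤ b →
      ∀ (ψ : Matrix.specialUnitaryGroup (Fin N) ℂ → ℝ) (M : ℝ), 0 ≤ M →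
        (∀ x y, |ψ x - ψ y| ≤ M * suFrobDist x y) →
        Var[ψ; (haarProbability (Matrix.specialUnitaryGroup (Fin N) ℂ)).tilted
          fun g => (N : ℝ) * ((g : Matrix (Fin N) (Fin N) ℂ) * B).trace.re] ≤ c * M ^ 2)
    (hVB : ∀ B : Matrix (Fin N) (Fin N) ℂ, matrixOpNorm B ≤ b → ∀ Δ : Matrix (Fin N) (Fin N) ℂ,
      Var[fun g : Matrix.specialUnitaryGroup (Fin N) ℂ =>
          (N : ℝ) * ((g : Matrix (Fin N) (Fin N) ℂ) * Δ).trace.re;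
        (haarProbability (Matrix.specialUnitaryGroup (Fin N) ℂ)).tilted
          fun g => (N : ℝ) * ((g : Matrix (Fin N) (Fin N) ℂ) * B).trace.re] ≤ v * frobNorm Δ ^ 2)
    (h : IsLinkSummable W B) (hWc : ∀ X, Continuous (W X))
    (hWdep : ∀ X, DependsOn (W X) (↑X : Set (ZdEdge d)))
    {osc : Finset (ZdEdge d) → ZdEdge d → ℝ} (hosc : ∀ X, Dobrushin.IsOscBound (W X) (osc X))
    (hoscs : ∀ e, Summable fun X : Finset (ZdEdge d) => (if e ∈ X then osc X e else 0))
    (hosca : ∀ e, ∑' X : Finset (ZdEdge d), (if e ∈ X then osc X e else 0) ≤ a)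
    {lip : Finset (ZdEdge d) → ZdEdge d → ℝ} (hlip : ∀ X, IsLipBound suFrobDist (W X) (lip X))
    {ℓ : ZdEdge d → ZdEdge d → ℝ}
    (hlips : ∀ e y, Summable fun X : Finset (ZdEdge d) => (if e ∈ X ∧ y ∈ X then lip X y else 0))
    (hℓ : ∀ e y, y ≠ e → ∑' X : Finset (ZdEdge d), (if e ∈ X ∧ y ∈ X then lip X y else 0) ≤ ℓ e y)
    (ht : 0 ≤ t) (hℓs : ∀ e, Summable fun y => (if y = e then 0 else ℓ e y) * exp (t * ‖e.1 - y.1‖))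
    (hℓt : ∀ e, ∑' y, (if y = e then 0 else ℓ e y) * exp (t * ‖e.1 - y.1‖) ≤ Λt)
    (hρ : 6 * ((d : ℝ) - 1) * |β| * (exp a * exp t * Real.sqrt (c * v)) + exp (a / 2) * Real.sqrt c * Λt < 1)
    {μ : Measure (LGConfig d (Matrix.specialUnitaryGroup (Fin N) ℂ))}
    (hμ : μ ∈ perturbedGibbsMeasuresS (d := d) (fundamentalRep (Fin N)) (N * β) W)
    (Λ : Finset (ZdEdge d)) (η : LGConfig d (Matrix.specialUnitaryGroup (Fin N) ℂ))
    {F : LGConfig d (Matrix.specialUnitaryGroup (Fin N) ℂ) → ℝ} {Δ : Finset (ZdEdge d)} {K : ℝ≥0}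
    (hF : IsLipschitzCylinder (fundamentalRep (Fin N)) F Δ K) {D : ℝ}
    (hD : ∀ y ∈ Δ, ∀ z, z ∉ Λ → D ≤ ‖y.1 - z.1‖) :
    |(∫ U, F U ∂(perturbedYMS (d := d) (fundamentalRep (Fin N)) (N * β) W Λ η)) - ∫ U, F U ∂μ| ≤
      2 * Real.sqrt N * K * Δ.card * exp (-(t * D)) := by
  classical
  haveI : SecondCountableTopology (Matrix (Fin N) (Fin N) ℂ) :=
    inferInstanceAs (SecondCountableTopology (Fin N → Fin N → ℂ))
  haveI : SecondCountableTopology (Matrix.specialUnitaryGroup (Fin N) ℂ) :=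
    Topology.IsEmbedding.subtypeVal.secondCountableTopology
  have hγ : IsSpecification (perturbedYMS (d := d) (fundamentalRep (Fin N)) (N * β) W) :=
    isSpecification_perturbedYMS _ (continuous_fundamentalRep (Fin N)) _ h hWc hWdep
  have hℓ0 : ∀ x y, y ≠ x → 0 ≤ ℓ x y := fun x y hyx => by
    refine le_trans (tsum_nonneg fun X => ?_) (hℓ x y hyx)
    split_ifs
    · exact (hlip X).nonneg y
    · exact le_rfl
  have hrow := fun x => summable_coeffS_row₀ (β := β) (c := c) (v := v) (a := a) hd hℓ0 ht hℓs hℓt x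
  have hℓs' : ∀ e, Summable fun y => (if y = e then 0 else ℓ e y) := fun e =>
    Summable.of_nonneg_of_le (fun y => by split_ifs with hye; exacts [le_rfl, hℓ0 e y hye])
      (fun y => le_mul_of_one_le_right (by split_ifs with hye; exacts [le_rfl, hℓ0 e y hye])
        (one_le_exp (by positivity))) (hℓs e)
  have hC0 : ∀ x y : ZdEdge d, 0 ≤ (if y = x then 0 else
      (exp a * Real.sqrt (c * v) * |β| * linkInfluence x y + exp (a / 2) * Real.sqrt c * ℓ x y)) :=
    fun x y => by
      split_ifs with hyx
      · exact le_rfl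
      · exact add_nonneg (by positivity) (mul_nonneg (by positivity) (hℓ0 x y hyx))
  have hρ0 : 0 ≤ 6 * ((d : ℝ) - 1) * |β| * (exp a * exp t * Real.sqrt (c * v)) + exp (a / 2) * Real.sqrt c * Λt := by
    have hd0 : 0 < d := hd
    let e₀ : ZdEdge d := (0, ⟨0, hd0⟩)
    exact (tsum_nonneg (hC0 e₀)).trans (hrow e₀).2.2.1
  have hRsqrt : (0 : ℝ) ≤ 2 * Real.sqrt N := by positivity
  have hμ' : IsGibbsMeasure (perturbedYMS (d := d) (fundamentalRep (Fin N)) (N * β) W) μ := hμ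
  haveI := hμ'.isProbabilityMeasure
  haveI := hγ.isProbability Λ η
  have hRHS : 0 ≤ 2 * Real.sqrt N * K * Δ.card * exp (-(t * D)) := by positivity
  -- the trivial case `Δ = ∅`: `F` is constant
  rcases Δ.eq_empty_or_nonempty with hΔ | hΔ
  · have hconst : ∀ U, F U = F 1 := fun U => hF.dependsOn (fun x hx => by simp [hΔ] at hx)
    simp only [hconst, integral_const, smul_eq_mul, probReal_univ, one_mul, sub_self, abs_zero, hΔ,
      Finset.card_empty, Nat.cast_zero, mul_zero, zero_mul, le_refl]
  obtain ⟨hp0, hpΛ, hpLip, hpΔ⟩ := depthProfileS (Λ := Λ) hΔ hD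
  have key := BoundaryDecayS.abs_kernel_sub_integral_le_exp_dist hγ (fun _ _ => suFrobDist_nonneg _ _) suFrobDist_le
    hRsqrt suFrobDist_self hC0 (fun x => (hrow x).1)
    (fun x ω η' φ L hφm hφb hL hφL => abs_integral_siteLaw_perturbedYMS_sub_le_tsum₀ hd hN hc hv hb hP hVB
      h hWc hWdep hosc hoscs hosca hlip hlips hℓ hℓs' x ω η' φ L hφm hφb hL hφL)
    hμ' Λ η hF.measurable hF.dependsOn hF.abs_le
    (hF.isLipBound zero_le_one (fun a b => by rw [one_mul]; exact dist_suEntries_le_suFrobDist a b))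
    hρ0 hρ (fun x y : ZdEdge d => ‖x.1 - y.1‖) (fun _ _ => norm_nonneg _) ht
    (fun x _ => (hrow x).2.1) (fun x _ => (hrow x).2.2.2) (fun y => max 0 (D - linkSetDist Δ y)) hp0 hpΛ
    (fun x _ y => hpLip x y) (m := D) hpΔ
  have hsum : ∑ y ∈ Δ, (if y ∈ Δ then 1 * (K : ℝ) else 0) = Δ.card * K := by
    rw [Finset.sum_ite_of_true (fun y hy => hy), Finset.sum_const, nsmul_eq_mul, one_mul]
  rw [hsum] at key
  calc |(∫ U, F U ∂(perturbedYMS (d := d) (fundamentalRep (Fin N)) (N * β) W Λ η)) - ∫ U, F U ∂μ|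
      ≤ 2 * Real.sqrt N * (Δ.card * K) * exp (-(t * D)) := key
    _ = 2 * Real.sqrt N * K * Δ.card * exp (-(t * D)) := by ring

end SUN


end Summit.Ventures.YMGap.RobustBall

end
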